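import Summits.CriticalPhenomena.PercolationContinuityZ3.Theorems.PercNearOneGluingNoHeavyLowerTailHullPortSelectionThreeTools
import HarnessLib

/-!
# `NoHeavyLowerTail` (stmt-CriticalPhenomena-4575) — hull-port line: SL(3,1) from the marker dominance inequality

Support file (prover `prim-ineq-prove-5`; `--supports stmt-CriticalPhenomena-4575`); no definitions, named facts or sorries.
Setting: bond percolation `μ = prodBernoulli w` on a finite vertex type, relays `A`, level `j`,
`R_v = {|π(v)| ≤ j}`; three observers `x₁, x₂, x₃`, a marker `z`; `U = C(x₁) ∪ C(x₂) ∪ C(x₃)`;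
`Θ'` = "the piece of `U` containing `z` is light if `z ∈ U`, else the piece of `x₁` is light" (the census event
SL(3,1) of ttrl2 `sellemma` — 0 / 962 313 798 exhaustive instances — with default `|π(U)| ≤ j`, is contained in `Θ'`).

`HullPort.selection_triple_of_markerDominance`: if `μ(R₂) ≤ μ(R₁)`, `μ(R₃) ≤ μ(R₁)` and the MARKER DOMINANCE
inequality holds for the single instance (`s = x₂`, `y = x₃`, marker `z`, avoided vertex `x₁`, test function
`1_{R₂} − 1_{R₁}`), then `μ(Θ') ≤ μ(R₁)`.  The marker dominance inequality (memo
`run/shared/lean/prim/prim-ineq-prove-5/SL3-PROOF.md` §4: for `C = C_s`, `D = {C ∩ X = ∅}` and every increasing `f`,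
`Cov_D(f(C), 1{z∈C}) ≥ μ(z ∈ C_y | C_y ∩ (X∪{s}) = ∅) · Cov_D(f(C), 1{y∈C})`) is CONJECTURAL — exact-arithmetic
census-clean (0 / 4 560 role instances, all up-sets, n ≤ 7; ttrl2 request `prove5-marker-dominance-lemma`), tight when
`z` is pendant to `y` — and enters only as the explicit real-number hypothesis `hMDL`.  With
`HullPort.selection_marker_core` (case `μ(R_z) ≤ max μ(R_{x_i})`, unconditional) this is the whole of SL(3,1); the tools
`zGlue_ratio_le` (the mass-balance coefficient is `≥ 0`) and `cpa_marker_step` are proved in the companion file.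
[cite: VandenbergHaggstromKahn2005, Thm. 1.3 (p. 6), Thm. 1.5 (p. 7) — corollaries via the tree's event forms]
-/

noncomputable section

namespace Summit.CriticalPhenomena.PercolationContinuityZ3.Theorems

open MeasureTheory Set Literature.Probability.LatticeModels Literature.Probability.Percolation
open scoped Classical

variable {V : Type*}

namespace HullPort

open KNPreFKG LonelyClusterExchange TwoClusterExchange

/-! ### SL(3,1) from the marker dominance inequality -/

/-- **Three-observer selection lemma, conditional on one instance of the marker dominance inequality.**
Observers `x₁, x₂, x₃`, marker `z`, relays `A`, level `j`, `R_v = {|π(v)| ≤ j}`.  Assume `μ(R₂) ≤ μ(R₁)`,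
`μ(R₃) ≤ μ(R₁)` and the marker dominance inequality for (`s = x₂`, `y = x₃`, marker `z`, avoided vertex `x₁`)
tested against `1_{R₂} − 1_{R₁}` — the real-number hypothesis `hMDL`, which reads
`μ(A₃)·Cov_{D}(1_{R₂} − 1_{R₁}, 1{x₂ ↔ z}) ≤ μ(A₃ ∩ {x₃ ↔ z})·Cov_{D}(1_{R₂} − 1_{R₁}, 1{x₂ ↔ x₃})` with
`D = {x₁ ↮ x₂}`, `A₃ = {x₃ ↮ x₁, x₂}`, `Cov_D(f,g) = μ(D)μ(fg;D) − μ(f;D)μ(g;D)` (conjectural in general; memo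
`prim-ineq-prove-5/SL3-PROOF.md` §4, §6).  Then the selected piece of `U = C(x₁) ∪ C(x₂) ∪ C(x₃)` (the piece of `z`
if `z ∈ U`, else the piece of `x₁`) is light with probability at most `μ(R₁)`.
Proof: bookkeeping `μ(Θ') − μ(R₁) ≤ [μ(D,x₂↔z,R₂) − μ(D,x₂↔z,R₁)] + [μ(E₃,R₃) − μ(E₃,R₁)]`; the first bracket is
handled by `hMDL`, the second by `cpa_marker_step`, the coefficient by `zGlue_ratio_le`, the degenerate case
`μ(A₃)·μ(D) = 0` by the pair exchange `lonelyClusterExchange_typeMinus`.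
[cite: VandenbergHaggstromKahn2005, Thm. 1.3 (p. 6), Thm. 1.5 (p. 7) — corollaries] -/
theorem selection_triple_of_markerDominance [Fintype V] (w : Sym2 V → unitInterval) (A : Finset V) (j : ℕ)
    (x₁ x₂ x₃ z : V) (h12 : x₁ ≠ x₂) (h13 : x₁ ≠ x₃) (h23 : x₂ ≠ x₃)
    (hI2 : (prodBernoulli w).real {ω : BondConfig V | (A.filter fun t => ω ∈ openConn x₂ t).card ≤ j} ≤
      (prodBernoulli w).real {ω : BondConfig V | (A.filter fun t => ω ∈ openConn x₁ t).card ≤ j})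
    (hI3 : (prodBernoulli w).real {ω : BondConfig V | (A.filter fun t => ω ∈ openConn x₃ t).card ≤ j} ≤
      (prodBernoulli w).real {ω : BondConfig V | (A.filter fun t => ω ∈ openConn x₁ t).card ≤ j})
    (hMDL :
      (prodBernoulli w).real {ω : BondConfig V | ∀ x ∈ ({x₁, x₂} : Set V), ¬ (openGraph ω).Reachable x₃ x} *
        ((prodBernoulli w).real ((openConn x₁ x₂ : Set (BondConfig V))ᶜ) *
          ((prodBernoulli w).real ((openConn x₁ x₂)ᶜ ∩ openConn x₂ z ∩
              {ω : BondConfig V | (A.filter fun t => ω ∈ openConn x₂ t).card ≤ j}) -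
            (prodBernoulli w).real ((openConn x₁ x₂)ᶜ ∩ openConn x₂ z ∩
              {ω : BondConfig V | (A.filter fun t => ω ∈ openConn x₁ t).card ≤ j})) -
          ((prodBernoulli w).real ((openConn x₁ x₂)ᶜ ∩
              {ω : BondConfig V | (A.filter fun t => ω ∈ openConn x₂ t).card ≤ j}) -
            (prodBernoulli w).real ((openConn x₁ x₂)ᶜ ∩
              {ω : BondConfig V | (A.filter fun t => ω ∈ openConn x₁ t).card ≤ j})) *
          (prodBernoulli w).real ((openConn x₁ x₂ : Set (BondConfig V))ᶜ ∩ openConn x₂ z)) ≤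
      (prodBernoulli w).real ({ω : BondConfig V | ∀ x ∈ ({x₁, x₂} : Set V), ¬ (openGraph ω).Reachable x₃ x} ∩
          openConn x₃ z) *
        ((prodBernoulli w).real ((openConn x₁ x₂ : Set (BondConfig V))ᶜ) *
          ((prodBernoulli w).real ((openConn x₁ x₂)ᶜ ∩ openConn x₂ x₃ ∩
              {ω : BondConfig V | (A.filter fun t => ω ∈ openConn x₂ t).card ≤ j}) -
            (prodBernoulli w).real ((openConn x₁ x₂)ᶜ ∩ openConn x₂ x₃ ∩
              {ω : BondConfig V | (A.filter fun t => ω ∈ openConn x₁ t).card ≤ j})) -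
          ((prodBernoulli w).real ((openConn x₁ x₂)ᶜ ∩
              {ω : BondConfig V | (A.filter fun t => ω ∈ openConn x₂ t).card ≤ j}) -
            (prodBernoulli w).real ((openConn x₁ x₂)ᶜ ∩
              {ω : BondConfig V | (A.filter fun t => ω ∈ openConn x₁ t).card ≤ j})) *
          (prodBernoulli w).real ((openConn x₁ x₂ : Set (BondConfig V))ᶜ ∩ openConn x₂ x₃))) :
    (prodBernoulli w).real {ω : BondConfig V |
        ((ω ∈ openConn z x₁ ∨ ω ∈ openConn z x₂ ∨ ω ∈ openConn z x₃) ∧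
          (A.filter fun t => ω ∈ openConn z t).card ≤ j) ∨
        (ω ∉ openConn z x₁ ∧ ω ∉ openConn z x₂ ∧ ω ∉ openConn z x₃ ∧
          (A.filter fun t => ω ∈ openConn x₁ t).card ≤ j)} ≤
      (prodBernoulli w).real {ω : BondConfig V | (A.filter fun t => ω ∈ openConn x₁ t).card ≤ j} := by
  set μ := prodBernoulli w with hμ
  have hmeas : ∀ S : Set (BondConfig V), MeasurableSet S := fun S => (Set.toFinite S).measurableSet
  set R1 : Set (BondConfig V) := {ω | (A.filter fun t => ω ∈ openConn x₁ t).card ≤ j} with hR1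
  set R2 : Set (BondConfig V) := {ω | (A.filter fun t => ω ∈ openConn x₂ t).card ≤ j} with hR2
  set R3 : Set (BondConfig V) := {ω | (A.filter fun t => ω ∈ openConn x₃ t).card ≤ j} with hR3
  set D12 : Set (BondConfig V) := (openConn x₁ x₂)ᶜ with hD12
  set Z2 : Set (BondConfig V) := openConn x₂ z with hZ2
  set X32 : Set (BondConfig V) := openConn x₂ x₃ with hX32
  set A3 : Set (BondConfig V) := {ω | ∀ x ∈ ({x₁, x₂} : Set V), ¬ (openGraph ω).Reachable x₃ x} with hA3
  set Z3 : Set (BondConfig V) := openConn x₃ z with hZ3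
  set E3 : Set (BondConfig V) := A3 ∩ Z3 with hE3
  set Θ : Set (BondConfig V) := {ω : BondConfig V |
        ((ω ∈ openConn z x₁ ∨ ω ∈ openConn z x₂ ∨ ω ∈ openConn z x₃) ∧
          (A.filter fun t => ω ∈ openConn z t).card ≤ j) ∨
        (ω ∉ openConn z x₁ ∧ ω ∉ openConn z x₂ ∧ ω ∉ openConn z x₃ ∧
          (A.filter fun t => ω ∈ openConn x₁ t).card ≤ j)} with hΘ
  change μ.real A3 * (μ.real D12 * (μ.real (D12 ∩ Z2 ∩ R2) - μ.real (D12 ∩ Z2 ∩ R1)) -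
      (μ.real (D12 ∩ R2) - μ.real (D12 ∩ R1)) * μ.real (D12 ∩ Z2)) ≤
    μ.real (A3 ∩ Z3) * (μ.real D12 * (μ.real (D12 ∩ X32 ∩ R2) - μ.real (D12 ∩ X32 ∩ R1)) -
      (μ.real (D12 ∩ R2) - μ.real (D12 ∩ R1)) * μ.real (D12 ∩ X32)) at hMDL
  change μ.real R2 ≤ μ.real R1 at hI2
  change μ.real R3 ≤ μ.real R1 at hI3
  change μ.real Θ ≤ μ.real R1
  -- relay filters agree along a connection
  have filter_eq : ∀ (ω : BondConfig V) (u v : V), (openGraph ω).Reachable u v →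
      (A.filter fun t => ω ∈ openConn v t) = (A.filter fun t => ω ∈ openConn u t) := by
    intro ω u v huv
    exact Finset.filter_congr fun t _ =>
      ⟨fun ht => (huv.trans ht : (openGraph ω).Reachable u t),
        fun ht => (huv.symm.trans ht : (openGraph ω).Reachable v t)⟩
  have mem_A3 : ∀ ω : BondConfig V, ω ∈ A3 ↔
      ¬ (openGraph ω).Reachable x₃ x₁ ∧ ¬ (openGraph ω).Reachable x₃ x₂ := by
    intro ω
    simp only [hA3, mem_setOf_eq, mem_insert_iff, mem_singleton_iff, forall_eq_or_imp, forall_eq]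
  /- (1) `h2 := μ(D12 ∩ R2) − μ(D12 ∩ R1) = μ(R2) − μ(R1) ≤ 0` -/
  have hDc12 : R2 \ D12 = R1 \ D12 := by
    ext ω
    simp only [hR1, hR2, hD12, mem_sdiff, mem_compl_iff, not_not, mem_setOf_eq]
    constructor
    · rintro ⟨h, hc⟩
      have hc' : (openGraph ω).Reachable x₁ x₂ := hc
      rw [filter_eq ω x₁ x₂ hc'] at h; exact ⟨h, hc⟩
    · rintro ⟨h, hc⟩
      have hc' : (openGraph ω).Reachable x₁ x₂ := hc
      rw [filter_eq ω x₁ x₂ hc']; exact ⟨h, hc⟩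
  have s1a : μ.real (R1 ∩ D12) + μ.real (R1 \ D12) = μ.real R1 := measureReal_inter_add_sdiff (hmeas D12)
  have s1b : μ.real (R2 ∩ D12) + μ.real (R2 \ D12) = μ.real R2 := measureReal_inter_add_sdiff (hmeas D12)
  have h2le : μ.real (D12 ∩ R2) - μ.real (D12 ∩ R1) ≤ 0 := by
    rw [inter_comm D12 R2, inter_comm D12 R1]; rw [hDc12] at s1b; linarith
  /- (2) `h3 := μ(D13 ∩ R3) − μ(D13 ∩ R1) = μ(R3) − μ(R1) ≤ 0`, `D13 = {x₁ ↮ x₃}`, and its split along `{x₂ ↔ x₃}`: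
     `μ(A3 ∩ R3) − μ(A3 ∩ R1) = h3 − (μ(D12 ∩ X32 ∩ R2) − μ(D12 ∩ X32 ∩ R1))` -/
  set D13 : Set (BondConfig V) := (openConn x₁ x₃)ᶜ with hD13
  have hDc13 : R3 \ D13 = R1 \ D13 := by
    ext ω
    simp only [hR1, hR3, hD13, mem_sdiff, mem_compl_iff, not_not, mem_setOf_eq]
    constructor
    · rintro ⟨h, hc⟩
      have hc' : (openGraph ω).Reachable x₁ x₃ := hc
      rw [filter_eq ω x₁ x₃ hc'] at h; exact ⟨h, hc⟩
    · rintro ⟨h, hc⟩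
      have hc' : (openGraph ω).Reachable x₁ x₃ := hc
      rw [filter_eq ω x₁ x₃ hc']; exact ⟨h, hc⟩
  have s2a : μ.real (R1 ∩ D13) + μ.real (R1 \ D13) = μ.real R1 := measureReal_inter_add_sdiff (hmeas D13)
  have s2b : μ.real (R3 ∩ D13) + μ.real (R3 \ D13) = μ.real R3 := measureReal_inter_add_sdiff (hmeas D13)
  have h3le : μ.real (R3 ∩ D13) - μ.real (R1 ∩ D13) ≤ 0 := by rw [hDc13] at s2b; linarith
  -- split `D13 ∩ R` along `X32`
  have eA3R : ∀ R : Set (BondConfig V), (R ∩ D13) \ X32 = A3 ∩ R := by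
    intro R; ext ω
    simp only [hD13, hX32, mem_sdiff, mem_inter_iff, mem_compl_iff, mem_A3]
    constructor
    · rintro ⟨⟨hR, h13'⟩, h23'⟩
      refine ⟨⟨fun h => h13' (h.symm : (openGraph ω).Reachable x₁ x₃),
        fun h => h23' (h.symm : (openGraph ω).Reachable x₂ x₃)⟩, hR⟩
    · rintro ⟨⟨h31', h32'⟩, hR⟩
      refine ⟨⟨hR, fun h => h31' ((h : (openGraph ω).Reachable x₁ x₃).symm)⟩,
        fun h => h32' ((h : (openGraph ω).Reachable x₂ x₃).symm)⟩
  have eD13X : (R3 ∩ D13) ∩ X32 = D12 ∩ X32 ∩ R2 := by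
    ext ω
    simp only [hD13, hD12, hX32, hR2, hR3, mem_inter_iff, mem_compl_iff, mem_setOf_eq]
    constructor
    · rintro ⟨⟨hR, h13'⟩, h23'⟩
      have h23'' : (openGraph ω).Reachable x₂ x₃ := h23'
      refine ⟨⟨fun h => h13' ?_, h23'⟩, ?_⟩
      · exact ((h : (openGraph ω).Reachable x₁ x₂).trans h23'' : (openGraph ω).Reachable x₁ x₃)
      · rw [← filter_eq ω x₂ x₃ h23'']; exact hR
    · rintro ⟨⟨h12', h23'⟩, hR⟩
      have h23'' : (openGraph ω).Reachable x₂ x₃ := h23'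
      refine ⟨⟨?_, fun h => h12' ?_⟩, h23'⟩
      · rw [filter_eq ω x₂ x₃ h23'']; exact hR
      · exact ((h : (openGraph ω).Reachable x₁ x₃).trans h23''.symm : (openGraph ω).Reachable x₁ x₂)
  have eD13X1 : (R1 ∩ D13) ∩ X32 = D12 ∩ X32 ∩ R1 := by
    ext ω
    simp only [hD13, hD12, hX32, mem_inter_iff, mem_compl_iff]
    constructor
    · rintro ⟨⟨hR, h13'⟩, h23'⟩
      have h23'' : (openGraph ω).Reachable x₂ x₃ := h23'
      exact ⟨⟨fun h => h13' ((h : (openGraph ω).Reachable x₁ x₂).trans h23'' : (openGraph ω).Reachable x₁ x₃),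
        h23'⟩, hR⟩
    · rintro ⟨⟨h12', h23'⟩, hR⟩
      have h23'' : (openGraph ω).Reachable x₂ x₃ := h23'
      exact ⟨⟨hR, fun h => h12' ((h : (openGraph ω).Reachable x₁ x₃).trans h23''.symm :
        (openGraph ω).Reachable x₁ x₂)⟩, h23'⟩
  have s3a : μ.real ((R3 ∩ D13) ∩ X32) + μ.real ((R3 ∩ D13) \ X32) = μ.real (R3 ∩ D13) :=
    measureReal_inter_add_sdiff (hmeas X32)
  have s3b : μ.real ((R1 ∩ D13) ∩ X32) + μ.real ((R1 ∩ D13) \ X32) = μ.real (R1 ∩ D13) :=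
    measureReal_inter_add_sdiff (hmeas X32)
  rw [eD13X, eA3R R3] at s3a
  rw [eD13X1, eA3R R1] at s3b
  -- step1: the CPA step
  have step1 := cpa_marker_step w A j x₁ x₂ x₃ z h13.symm h23.symm
  change μ.real A3 * (μ.real (A3 ∩ Z3 ∩ R3) - μ.real (A3 ∩ Z3 ∩ R1)) ≤
    μ.real (A3 ∩ Z3) * (μ.real (A3 ∩ R3) - μ.real (A3 ∩ R1)) at step1
  -- λ ≥ 0
  have hlam := zGlue_ratio_le w x₁ x₂ x₃ z h13.symm
  have eA3' : ((openConn x₃ x₁ : Set (BondConfig V))ᶜ ∩ (openConn x₃ x₂)ᶜ) = A3 := by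
    ext ω; simp only [mem_inter_iff, mem_compl_iff, mem_A3]; exact Iff.rfl
  rw [eA3'] at hlam
  change μ.real (A3 ∩ Z3) * μ.real (D12 ∩ X32) ≤ μ.real A3 * μ.real (D12 ∩ Z2) at hlam
  -- the pair exchange for `(x₁, x₂)` with selector `{x₂ ↔ z}`: `ac ≤ 0`
  have hBt : ∀ ⦃ω ω' : BondConfig V⦄, openEdgeCluster ω' x₁ ⊆ openEdgeCluster ω x₁ →
      openEdgeCluster ω x₂ ⊆ openEdgeCluster ω' x₂ → ω ∈ Z2 → ω' ∈ Z2 :=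
    fun ω ω' hs ht hω => typeMinus_openConn x₁ x₂ z hs ht hω
  have ex := lonelyClusterExchange_typeMinus w h12 A j hBt
  change μ.real (D12 ∩ (R2 ∩ Z2)) * μ.real (D12 ∩ R1) ≤ μ.real (D12 ∩ R2) * μ.real (D12 ∩ (Z2 ∩ R1)) at ex
  have eZR2 : D12 ∩ (R2 ∩ Z2) = D12 ∩ Z2 ∩ R2 := by
    ext ω; simp only [mem_inter_iff]; tauto
  have eZR1 : D12 ∩ (Z2 ∩ R1) = D12 ∩ Z2 ∩ R1 := by rw [inter_assoc]
  rw [eZR2, eZR1] at ex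
  have hD12le : μ.real (D12 ∩ R2) ≤ μ.real (D12 ∩ R1) := by linarith [h2le]
  have hac : μ.real (D12 ∩ Z2 ∩ R2) - μ.real (D12 ∩ Z2 ∩ R1) ≤ 0 := by
    by_cases h0 : μ.real (D12 ∩ R1) = 0
    · have h1 : μ.real (D12 ∩ R2) ≤ 0 := by rw [h0] at hD12le; exact hD12le
      have h2 : μ.real (D12 ∩ Z2 ∩ R2) ≤ μ.real (D12 ∩ R2) :=
        measureReal_mono (fun ω ⟨⟨hd, _⟩, hr⟩ => ⟨hd, hr⟩) (measure_ne_top _ _)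
      linarith [measureReal_nonneg (μ := μ) (s := D12 ∩ Z2 ∩ R1), measureReal_nonneg (μ := μ) (s := D12 ∩ Z2 ∩ R2)]
    · have hpos : 0 < μ.real (D12 ∩ R1) := lt_of_le_of_ne measureReal_nonneg (Ne.symm h0)
      have h3 : μ.real (D12 ∩ R2) * μ.real (D12 ∩ Z2 ∩ R1) ≤ μ.real (D12 ∩ R1) * μ.real (D12 ∩ Z2 ∩ R1) :=
        mul_le_mul_of_nonneg_right hD12le measureReal_nonneg
      have h4 : μ.real (D12 ∩ Z2 ∩ R2) * μ.real (D12 ∩ R1) ≤ μ.real (D12 ∩ Z2 ∩ R1) * μ.real (D12 ∩ R1) := by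
        calc μ.real (D12 ∩ Z2 ∩ R2) * μ.real (D12 ∩ R1) ≤ μ.real (D12 ∩ R2) * μ.real (D12 ∩ Z2 ∩ R1) := ex
          _ ≤ μ.real (D12 ∩ R1) * μ.real (D12 ∩ Z2 ∩ R1) := h3
          _ = μ.real (D12 ∩ Z2 ∩ R1) * μ.real (D12 ∩ R1) := mul_comm _ _
      have := le_of_mul_le_mul_right h4 hpos
      linarith
  /- (3) the core inequality `ac + b ≤ 0` -/
  have hP : 0 ≤ μ.real A3 := measureReal_nonneg
  have hQ : 0 ≤ μ.real (A3 ∩ Z3) := measureReal_nonneg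
  have hd : 0 ≤ μ.real D12 := measureReal_nonneg
  have hmZ : 0 ≤ μ.real (D12 ∩ Z2) := measureReal_nonneg
  have hQP : μ.real (A3 ∩ Z3) ≤ μ.real A3 := measureReal_mono inter_subset_left (measure_ne_top _ _)
  -- `μ(A3 ∩ R3) − μ(A3 ∩ R1) = h3 − cg`
  have hsplit : μ.real (A3 ∩ R3) - μ.real (A3 ∩ R1) =
      (μ.real (R3 ∩ D13) - μ.real (R1 ∩ D13)) -
        (μ.real (D12 ∩ X32 ∩ R2) - μ.real (D12 ∩ X32 ∩ R1)) := by linarith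
  have hcore : μ.real (D12 ∩ Z2 ∩ R2) - μ.real (D12 ∩ Z2 ∩ R1) +
      (μ.real (A3 ∩ Z3 ∩ R3) - μ.real (A3 ∩ Z3 ∩ R1)) ≤ 0 := by
    -- main product inequality: `P·d·(ac + b) ≤ Q·d·h3 + h2·(P·mZ − Q·mX) ≤ 0`
    have hmain : μ.real A3 * μ.real D12 * (μ.real (D12 ∩ Z2 ∩ R2) - μ.real (D12 ∩ Z2 ∩ R1) +
        (μ.real (A3 ∩ Z3 ∩ R3) - μ.real (A3 ∩ Z3 ∩ R1))) ≤ 0 := by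
      have t1 : μ.real D12 * (μ.real A3 * (μ.real (A3 ∩ Z3 ∩ R3) - μ.real (A3 ∩ Z3 ∩ R1))) ≤
          μ.real D12 * (μ.real (A3 ∩ Z3) * (μ.real (A3 ∩ R3) - μ.real (A3 ∩ R1))) :=
        mul_le_mul_of_nonneg_left step1 hd
      have t2 : (μ.real (D12 ∩ R2) - μ.real (D12 ∩ R1)) *
          (μ.real A3 * μ.real (D12 ∩ Z2) - μ.real (A3 ∩ Z3) * μ.real (D12 ∩ X32)) ≤ 0 :=
        mul_nonpos_of_nonpos_of_nonneg h2le (by linarith [hlam])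
      have t3 : μ.real (A3 ∩ Z3) * μ.real D12 * (μ.real (R3 ∩ D13) - μ.real (R1 ∩ D13)) ≤ 0 :=
        mul_nonpos_of_nonneg_of_nonpos (mul_nonneg hQ hd) h3le
      rw [hsplit] at t1
      nlinarith [hMDL, t1, t2, t3]
    by_cases hPd : μ.real A3 * μ.real D12 = 0
    · rcases mul_eq_zero.1 hPd with hP0 | hd0
      · -- `μ(A3) = 0`: the `E3`-terms vanish, `ac ≤ 0` by the pair exchange
        have e0 : μ.real (A3 ∩ Z3 ∩ R3) = 0 := le_antisymm
          (le_trans (measureReal_mono (fun ω ⟨⟨h, _⟩, _⟩ => h) (measure_ne_top _ _)) hP0.le) measureReal_nonneg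
        have e0' : μ.real (A3 ∩ Z3 ∩ R1) = 0 := le_antisymm
          (le_trans (measureReal_mono (fun ω ⟨⟨h, _⟩, _⟩ => h) (measure_ne_top _ _)) hP0.le) measureReal_nonneg
        rw [e0, e0']; linarith [hac]
      · -- `μ(D12) = 0`: the `D12`-terms vanish and `P·b ≤ Q·h3 ≤ 0`
        have z1 : ∀ S : Set (BondConfig V), μ.real (D12 ∩ S) = 0 := fun S => le_antisymm
          (le_trans (measureReal_mono inter_subset_left (measure_ne_top _ _)) hd0.le) measureReal_nonneg
        have z2 : μ.real (D12 ∩ Z2 ∩ R2) = 0 := by rw [inter_assoc]; exact z1 _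
        have z3 : μ.real (D12 ∩ Z2 ∩ R1) = 0 := by rw [inter_assoc]; exact z1 _
        have z4 : μ.real (D12 ∩ X32 ∩ R2) = 0 := by rw [inter_assoc]; exact z1 _
        have z5 : μ.real (D12 ∩ X32 ∩ R1) = 0 := by rw [inter_assoc]; exact z1 _
        rw [z2, z3]
        rw [z4, z5] at hsplit
        by_cases hP0 : μ.real A3 = 0
        · have e0 : μ.real (A3 ∩ Z3 ∩ R3) = 0 := le_antisymm
            (le_trans (measureReal_mono (fun ω ⟨⟨h, _⟩, _⟩ => h) (measure_ne_top _ _)) hP0.le) measureReal_nonneg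
          have e0' : μ.real (A3 ∩ Z3 ∩ R1) = 0 := le_antisymm
            (le_trans (measureReal_mono (fun ω ⟨⟨h, _⟩, _⟩ => h) (measure_ne_top _ _)) hP0.le) measureReal_nonneg
          rw [e0, e0']; linarith
        · have hPpos : 0 < μ.real A3 := lt_of_le_of_ne hP (Ne.symm hP0)
          have t4 : μ.real (A3 ∩ Z3) * (μ.real (A3 ∩ R3) - μ.real (A3 ∩ R1)) ≤ 0 := by
            rw [hsplit]; exact mul_nonpos_of_nonneg_of_nonpos hQ (by linarith [h3le])
          have t5 : μ.real A3 * (μ.real (A3 ∩ Z3 ∩ R3) - μ.real (A3 ∩ Z3 ∩ R1)) ≤ 0 := le_trans step1 t4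
          have t6 : μ.real (A3 ∩ Z3 ∩ R3) - μ.real (A3 ∩ Z3 ∩ R1) ≤ 0 := by
            by_contra hc
            have := mul_pos hPpos (not_le.mp hc)
            linarith
          linarith
    · have hPdpos : 0 < μ.real A3 * μ.real D12 := lt_of_le_of_ne (mul_nonneg hP hd) (Ne.symm hPd)
      by_contra hc
      have := mul_pos hPdpos (not_le.mp hc)
      linarith
  /- (4) bookkeeping: `μ(Θ) − μ(R1) ≤ ac + b` -/
  set S1 : Set (BondConfig V) := openConn z x₁ with hS1
  set N : Set (BondConfig V) := (openConn z x₁)ᶜ ∩ (openConn z x₂)ᶜ ∩ (openConn z x₃)ᶜ with hN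
  have hΘsub : Θ ⊆ (S1 ∩ R1) ∪ (D12 ∩ Z2 ∩ R2) ∪ (A3 ∩ Z3 ∩ R3) ∪ (N ∩ R1) := by
    intro ω hω
    simp only [hΘ, mem_setOf_eq] at hω
    rcases hω with ⟨hzU, hRz⟩ | ⟨hn1, hn2, hn3, hR1'⟩
    · by_cases hz1 : ω ∈ (openConn z x₁ : Set (BondConfig V))
      · have hz1' : (openGraph ω).Reachable z x₁ := hz1
        refine Or.inl (Or.inl (Or.inl ⟨hz1, ?_⟩))
        simp only [hR1, mem_setOf_eq]; rw [filter_eq ω z x₁ hz1']; exact hRz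
      by_cases hz2 : ω ∈ (openConn z x₂ : Set (BondConfig V))
      · have hz2' : (openGraph ω).Reachable z x₂ := hz2
        refine Or.inl (Or.inl (Or.inr ⟨⟨?_, (hz2'.symm : (openGraph ω).Reachable x₂ z)⟩, ?_⟩))
        · intro h12'
          exact hz1 (hz2'.trans (h12' : (openGraph ω).Reachable x₁ x₂).symm : (openGraph ω).Reachable z x₁)
        · simp only [hR2, mem_setOf_eq]; rw [filter_eq ω z x₂ hz2']; exact hRz
      have hz3 : ω ∈ (openConn z x₃ : Set (BondConfig V)) := by
        rcases hzU with h | h | h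
        · exact absurd h hz1
        · exact absurd h hz2
        · exact h
      have hz3' : (openGraph ω).Reachable z x₃ := hz3
      refine Or.inl (Or.inr ⟨⟨(mem_A3 ω).2 ⟨?_, ?_⟩, (hz3'.symm : (openGraph ω).Reachable x₃ z)⟩, ?_⟩)
      · intro h; exact hz1 (hz3'.trans h : (openGraph ω).Reachable z x₁)
      · intro h; exact hz2 (hz3'.trans h : (openGraph ω).Reachable z x₂)
      · simp only [hR3, mem_setOf_eq]; rw [filter_eq ω z x₃ hz3']; exact hRz
    · exact Or.inr ⟨⟨⟨hn1, hn2⟩, hn3⟩, hR1'⟩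
  have hΘle : μ.real Θ ≤ μ.real (S1 ∩ R1) + μ.real (D12 ∩ Z2 ∩ R2) + μ.real (A3 ∩ Z3 ∩ R3) + μ.real (N ∩ R1) := by
    calc μ.real Θ ≤ μ.real ((S1 ∩ R1) ∪ (D12 ∩ Z2 ∩ R2) ∪ (A3 ∩ Z3 ∩ R3) ∪ (N ∩ R1)) :=
          measureReal_mono hΘsub (measure_ne_top _ _)
      _ ≤ μ.real ((S1 ∩ R1) ∪ (D12 ∩ Z2 ∩ R2) ∪ (A3 ∩ Z3 ∩ R3)) + μ.real (N ∩ R1) := measureReal_union_le _ _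
      _ ≤ μ.real ((S1 ∩ R1) ∪ (D12 ∩ Z2 ∩ R2)) + μ.real (A3 ∩ Z3 ∩ R3) + μ.real (N ∩ R1) := by
          linarith [measureReal_union_le (μ := μ) ((S1 ∩ R1) ∪ (D12 ∩ Z2 ∩ R2)) (A3 ∩ Z3 ∩ R3)]
      _ ≤ μ.real (S1 ∩ R1) + μ.real (D12 ∩ Z2 ∩ R2) + μ.real (A3 ∩ Z3 ∩ R3) + μ.real (N ∩ R1) := by
          linarith [measureReal_union_le (μ := μ) (S1 ∩ R1) (D12 ∩ Z2 ∩ R2)]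
  -- disjointness of the four selectors
  have dj12 : Disjoint (S1 ∩ R1) (D12 ∩ Z2 ∩ R1) := by
    rw [Set.disjoint_left]
    rintro ω ⟨hz1, -⟩ ⟨⟨hd, hz2⟩, -⟩
    have hz1' : (openGraph ω).Reachable z x₁ := hz1
    have hz2' : (openGraph ω).Reachable x₂ z := hz2
    exact hd ((hz2'.trans hz1').symm : (openGraph ω).Reachable x₁ x₂)
  have dj13 : Disjoint ((S1 ∩ R1) ∪ (D12 ∩ Z2 ∩ R1)) (A3 ∩ Z3 ∩ R1) := by
    rw [Set.disjoint_left]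
    rintro ω (⟨hz1, -⟩ | ⟨⟨-, hz2⟩, -⟩) ⟨⟨hA, hz3⟩, -⟩
    · have hz1' : (openGraph ω).Reachable z x₁ := hz1
      have hz3' : (openGraph ω).Reachable x₃ z := hz3
      exact ((mem_A3 ω).1 hA).1 (hz3'.trans hz1')
    · have hz2' : (openGraph ω).Reachable x₂ z := hz2
      have hz3' : (openGraph ω).Reachable x₃ z := hz3
      exact ((mem_A3 ω).1 hA).2 (hz3'.trans hz2'.symm)
  have dj4 : Disjoint (((S1 ∩ R1) ∪ (D12 ∩ Z2 ∩ R1)) ∪ (A3 ∩ Z3 ∩ R1)) (N ∩ R1) := by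
    rw [Set.disjoint_left]
    rintro ω ((⟨hz1, -⟩ | ⟨⟨-, hz2⟩, -⟩) | ⟨⟨-, hz3⟩, -⟩) ⟨⟨⟨hn1, hn2⟩, hn3⟩, -⟩
    · exact hn1 hz1
    · exact hn2 ((hz2 : (openGraph ω).Reachable x₂ z).symm : (openGraph ω).Reachable z x₂)
    · exact hn3 ((hz3 : (openGraph ω).Reachable x₃ z).symm : (openGraph ω).Reachable z x₃)
  have hR1ge : μ.real (S1 ∩ R1) + μ.real (D12 ∩ Z2 ∩ R1) + μ.real (A3 ∩ Z3 ∩ R1) + μ.real (N ∩ R1) ≤ μ.real R1 := by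
    have u1 : μ.real ((S1 ∩ R1) ∪ (D12 ∩ Z2 ∩ R1)) = μ.real (S1 ∩ R1) + μ.real (D12 ∩ Z2 ∩ R1) :=
      measureReal_union dj12 (hmeas _)
    have u2 : μ.real (((S1 ∩ R1) ∪ (D12 ∩ Z2 ∩ R1)) ∪ (A3 ∩ Z3 ∩ R1)) =
        μ.real ((S1 ∩ R1) ∪ (D12 ∩ Z2 ∩ R1)) + μ.real (A3 ∩ Z3 ∩ R1) := measureReal_union dj13 (hmeas _)
    have u3 : μ.real ((((S1 ∩ R1) ∪ (D12 ∩ Z2 ∩ R1)) ∪ (A3 ∩ Z3 ∩ R1)) ∪ (N ∩ R1)) =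
        μ.real (((S1 ∩ R1) ∪ (D12 ∩ Z2 ∩ R1)) ∪ (A3 ∩ Z3 ∩ R1)) + μ.real (N ∩ R1) :=
      measureReal_union dj4 (hmeas _)
    have hsub : (((S1 ∩ R1) ∪ (D12 ∩ Z2 ∩ R1)) ∪ (A3 ∩ Z3 ∩ R1)) ∪ (N ∩ R1) ⊆ R1 := by
      rintro ω (((⟨-, h⟩ | ⟨-, h⟩) | ⟨-, h⟩) | ⟨-, h⟩) <;> exact h
    have := measureReal_mono (μ := μ) hsub (measure_ne_top _ _)
    linarith
  linarith [hcore]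

end HullPort

end Summit.CriticalPhenomena.PercolationContinuityZ3.Theorems

end
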